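import Mathlib
import Summits.Ventures.PercRepro2.SwOutCrossGenKEDefs

/-!
# The attachment toggle of a fibre (blind cell PercRepro2, night-4 g24, 2026-08-28;
proofs/NIGHT4-G24.md §6)

The fibre `attToggle w` of a fibre point `w = (uP, c, e)` of a connected dropped component: the
u-edges flipped, the cross edges at an ATTACHED end flipped, the outside bits of the attached
vertices flipped — the fibre of the realisation after the flip of an arm-closed set containing `u`
on the T-slab.  **`attE_attToggle_flip`**: the attached vertices of the FLIP of the toggled fibre
(the blue-attached vertices after the toggle) are exactly the attached vertices of the fibre — a
walk of the link graph of the flipped toggle ends at `u` only through attached vertices, and a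
walk of the link graph of `w` to `u` is kept.  `attToggle_flip_flip`: the flip of the toggle of
the flipped fibre is the toggle along the blue-attached vertices (the B-slab form).
-/

namespace Summit.Ventures.PercRepro2

namespace CrossArm

open scoped Classical

section AttToggle

variable {X : Type*} {G : SimpleGraph X}

/-- The fibre toggled along its attached vertices: the u-edges flipped, the cross edges at an
attached end flipped, the outside bits of the attached vertices flipped. -/
noncomputable def attToggle (G : SimpleGraph X) (w : FibKE X G) : FibKE X G :=
  (fun i => !w.1 i, fun s => if ∃ i ∈ s.1, attE G w i then !w.2.1 s else w.2.1 s,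
    fun i => if attE G w i then !w.2.2 i else w.2.2 i)

/-- The flip of the toggled fibre has the u-edges of the fibre. -/
lemma attToggle_flip_fst (w : FibKE X G) : (attToggle G w).flip.1 = w.1 := by
  funext i; simp [attToggle, FibKE.flip]

/-- The flip of the toggled fibre has the colour of the fibre on a cross edge at an attached end. -/
lemma attToggle_flip_cross_att (w : FibKE X G) {s : G.edgeSet} (hs : ∃ i ∈ s.1, attE G w i) :
    (attToggle G w).flip.2.1 s = w.2.1 s := by
  simp [attToggle, FibKE.flip, if_pos hs]

/-- An attached vertex of the flip of the toggled fibre is attached at the fibre. -/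
lemma attE_of_attE_attToggle_flip (w : FibKE X G) :
    ∀ {x y : Option X}, (GlinkE G (attToggle G w).flip).Walk x y →
      (y = none ∨ ∃ j, y = some j ∧ attE G w j) → x = none ∨ ∃ i, x = some i ∧ attE G w i := by
  intro x y wk
  induction wk with
  | nil => exact id
  | @cons a b c hadj _ ih =>
    intro hc
    rcases ih hc with rfl | ⟨j, rfl, hj⟩
    · cases a with
      | none => exact Or.inl rfl
      | some i =>
        have hi : (attToggle G w).flip.1 i = true := hadj
        rw [attToggle_flip_fst] at hi
        exact Or.inr ⟨i, rfl, attE_of_uP G hi⟩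
    · cases a with
      | none => exact Or.inl rfl
      | some i =>
        obtain ⟨hij, hc'⟩ := hadj
        rw [attToggle_flip_cross_att w ⟨j, Sym2.mem_mk_right _ _, hj⟩] at hc'
        exact Or.inr ⟨i, rfl, attE_of_adj G hij hc' hj⟩

/-- A walk of the link graph of the fibre ending at `u` is a walk of the link graph of the flip
of the toggled fibre. -/
lemma reachable_attToggle_flip_of_walk (w : FibKE X G) :
    ∀ {x y : Option X}, (GlinkE G w).Walk x y → y = none →
      (GlinkE G (attToggle G w).flip).Reachable x none := by
  intro x y wk
  induction wk with
  | nil => rintro rfl; exact SimpleGraph.Reachable.refl _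
  | @cons a b c hadj wk' ih =>
    intro hc
    subst hc
    refine SimpleGraph.Reachable.trans (SimpleGraph.Adj.reachable ?_) (ih rfl)
    cases a with
    | none =>
      cases b with
      | none => exact absurd hadj ((GlinkE G w).loopless.irrefl none)
      | some j =>
        have hj : w.1 j = true := hadj
        show (attToggle G w).flip.1 j = true
        rw [attToggle_flip_fst]; exact hj
    | some i =>
      cases b with
      | none =>
        have hi : w.1 i = true := hadj
        show (attToggle G w).flip.1 i = true
        rw [attToggle_flip_fst]; exact hi
      | some j =>
        obtain ⟨hij, hc⟩ := hadj
        have hj : attE G w j := ⟨wk'⟩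
        refine ⟨hij, ?_⟩
        rw [attToggle_flip_cross_att w ⟨j, Sym2.mem_mk_right _ _, hj⟩]
        exact hc

/-- **The attached vertices of the flip of the toggled fibre are the attached vertices of the
fibre.** -/
theorem attE_attToggle_flip (w : FibKE X G) (i : X) :
    attE G (attToggle G w).flip i ↔ attE G w i := by
  constructor
  · intro hi
    rcases attE_of_attE_attToggle_flip w hi.some (Or.inl rfl) with h' | ⟨i', hi', hatt⟩
    · exact absurd h' (Option.some_ne_none i)
    · rw [Option.some.injEq] at hi'
      rw [hi']; exact hatt
  · intro hi
    exact reachable_attToggle_flip_of_walk w hi.some rfl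

/-- The flip of the toggled fibre of the flipped fibre is the toggle along the blue-attached
vertices. -/
lemma attToggle_flip_flip (w : FibKE X G) :
    (attToggle G w.flip).flip =
      (fun i => !w.1 i, fun s => if ∃ i ∈ s.1, attE G w.flip i then !w.2.1 s else w.2.1 s,
        fun i => if attE G w.flip i then !w.2.2 i else w.2.2 i) := by
  simp only [attToggle, FibKE.flip, Bool.not_not]
  refine Prod.ext rfl (Prod.ext ?_ ?_)
  · funext s
    by_cases hs : ∃ i ∈ s.1, attE G (fun i => !w.1 i, fun s => !w.2.1 s, fun i => !w.2.2 i) i <;>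
      simp [hs]
  · funext i
    by_cases hi : attE G (fun i => !w.1 i, fun s => !w.2.1 s, fun i => !w.2.2 i) i <;> simp [hi]

end AttToggle

end CrossArm

end Summit.Ventures.PercRepro2
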